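import Literature.MathematicalPhysics.QuantumFieldTheory.Balaban1983to89.B9Eq349FlatDPBlockDecay

/-!
# `Balaban1983to89.B9Eq349FlatPBlockDecay` — T. Bałaban, *Propagators for lattice gauge theories in a background field*, Commun. Math. Phys. **99** (1985)
# 389–434 [Balaban1985BackgroundPropagators] (3.49) p. 399, (3.25) p. 394, [Balaban1984PropagatorsI] (1.44)–(1.45), [Balaban1983RegularityDecay] (2.48):
# **SITES→SITES BLOCK DECAY OF THE FLAT `P(1) = 1 − R(1) = G′(1)Q̃′†c(1)Q̃′G′(1)` — `‖1_{Δ(y₁)} ∘ (1 − R(1)) ∘ 1_{Δ(y₀)}‖ ≤ L^{d+1}·K_{A₀}K_cK_B·K_{d+1}(κ₀ − r)²·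
# e^{−r·d_m(y₀,y₁)}` for every `0 ≤ r < κ₀` (the cell's flat strip rate), and the `∃ r C`-package with the VOLUME inside — the three-kernel cousin of
# ne9-leaf-06's `B9Eq349FlatDPBlockDecay` (which differentiates the left factor: `D_1(1 − R(1))`, bonds←sites)** — the sites→sites block-decay letter that
# this lineage's `B9Eq389CutoffTailFromBlockDecay` turns into S-P6′(β)'s `hτ` at `U ≡ 1`

statement-level skeleton of published theorems with citation tags; proofs where landed; nothing here is a claim about the Yang–Mills mass gap

CITATION HEADER (lean-in-tree rule).  Audit cell `pub-balaban`, sub-cell `t4`, BINDER row NE9; filed by NE9 formalisation-swarm LEAF PROVER 05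
(`b2b-balaban-t4-ne9-formalise-leaf-05`, gen 76), route R2′ STEP B8′ S-P6′(β) ∕ road B8″ (ROUTES-NE9 §L1.2).  CREDIT: the kernel identity and the assembly are
ne9-leaf-06 g68's `B9Eq349FlatDPBlockDecay` §1–§3 with the left factor `D_1G′(1)Q̃′†` replaced by `G′(1)Q̃′†` (their `B9Eq349FlatDGQKernel.equiv_GpQadj_one_apply`
instead of `equiv_D_GpQadj_one_apply`) and the sites→bonds block step replaced by the generic `B9Eq349BlockDecayFromKernel.opNorm_block_comp_comp_block_le`
at `π_S = π_E = blockCoord`; the kernel letters `norm_KT_liftSite_le` ∕ `norm_flatc_le` ∕ `norm_flatB_le`, `B9Eq349KernelConvolutionDecay.norm_conv3_le`,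
`B9Eq325ProjFormula.RofU_eq_formula_one` (leaf-06), the cells' torus decays `B4Torus248Decay` ∕ `B5Torus145Decay` — all BY NAME.  Sources READ:
[Balaban1985BackgroundPropagators] p. 399 (3.49) *«… ≤ O(1)e^{−δ₀d(y,y′)}‖f‖ for x ∈ Δ(y), supp f ⊂ Δ(y′)»* (print states the decay for `P`'s kernel
itself — this file's shape — as well as for `DP`), p. 394 (3.25); [B5′] p. 38.  Print's `δ₀` is NOT valued; the rate is the cell's crude `κ₀`.

WHAT IS PROVED (sorry-free; proof lane — no `def`; [folklore] composition on landed theorems; dimension `d+1`).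
* §1 **`equiv_flatP_apply`** — the kernel of `1 − R(1)`: `((1 − R(1))f)(x) = Σ_{x′} (Σ_{y,y′} A₀(x,y)·c(y,y′)·B(y′,x′))•f(x′)`, `A₀ = ρ·K_T(x̂,ŷ)` (undifferentiated).
* §2 **`flat_P_block_decay`** — from the displayed torus letters `hbA`, `hbc` at a common rate `κ₀ > 0` and any `0 ≤ r < κ₀`: for every block family `P^S` on the
  fine sites and all `y₀, y₁`, `‖P^S_{y₁} ∘L (1 − R(1)) ∘L P^S_{y₀}‖ ≤ L^{d+1}·(K_{A₀}·K_c·K_B·K_{d+1}(κ₀−r)²)·e^{−(r·d_m(y₀,y₁))}`, `K_{A₀} = ρM_A`, `K_c = σ⁻¹M_c`,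
  `K_B = (c₀∕c₁)ρM_A`.
* §3 **`exists_flat_P_block_decay`** — the package: `∃ r > 0, C ≥ 0`, `∀` volume `N`, block family, `y₀, y₁` (the torus decays discharged at `a′ := 1`, `c₁ := c₀`).
HONEST SCOPE.  Flat background ONLY; SHAPE not SIZE (the cell's crude `κ₀`, `C` astronomically large — t4-ne9-idea-1 g103's evaluation applies verbatim);
`R(1)` is `a′`-free, the auxiliary `(a′, c₁)` only parametrise (3.25).  NOT NE9 (cell pub-balaban: NE9 NOT PRINTED ∕ NOT PROVED; «NE9 ⇐ the named binders»; row
WALLED ON A MODEL (O-NE9-1; #5 UNRULED); spine PROVED 0∕9; rung (B)+1 on a finite T⁴ — NOT infinite volume, NOT mass gap, NOT BetaPertH, NOT Clay; HONEST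
DEPENDENCY: continuum YM on T⁴ ⇐ BetaPertH ∧ nine spine estimates (0/9 proved); BetaPertH ⇐ (D1) ∧ (D4) ∧ CAP+tail; G-an2-4 gates asym, D1 and NE2/3/4).
NEW file importing `B9Eq349FlatDPBlockDecay` (⊇ everything named); nothing modified.  Net new unproved facts: 0.
-/

noncomputable section

set_option autoImplicit false

open scoped BigOperators InnerProductSpace ComplexConjugate

namespace Literature.MathematicalPhysics.QuantumFieldTheory.Balaban1983to89.B9Eq349FlatPBlockDecay

open B4Sect5Torus (TSite tdist tdist_symm tdist_nonneg tdist_triangle torusSum_le)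
open B4TorusKernel (periodConst)
open B4Sect5Proof (latticeConst latticeConst_nonneg)
open B9SectCLatticeCarrier (Bond)
open B9Eq311L2Pairing (WL2)
open B9Eq319QprimeTorus (fineP blockCoord)
open B11Eq103H1Complex (SiteL2K greenK)
open B9Eq310HessianOperator (adTransportW)
open B9Eq326OperatorAssembly (QprimeW RofU)
open B9Eq3119DeltaPiCarrier (laplacePrimeA GpOfU)
open B9Thm311DeltaPrimeA (laplacePrimeA_one_pos)
open B9Eq325ProjFormula (QGGQ_pos_one RofU_eq_formula_one)
open B9Eq315QTorusOnto (liftSite)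
open B4Torus248Decay (torusKernel248 kernel248_torusKernel_decay_torusMetric)
open B4TorusKernel.MultiPeriod (torusSupNorm torusSupNorm_nonneg)
open B4TorusGreen244 (KT)
open B5Torus145Decay (torusKernel145M inverse145_torusKernelM_decay_torusMetric)
open B9Eq365QGGQFlatCarrierDictionary (one_le_period)
open B9Eq349FlatDGQKernel (equiv_GpQadj_one_apply norm_KT_liftSite_le)
open B9Eq349FlatQGKernel (equiv_QGp_one_apply norm_flatB_le)
open B9Eq349FlatQGGQInvKernel (equiv_greenK_QGGQ_one_apply norm_flatc_le)
open B9Eq349KernelConvolutionDecay (norm_conv3_le)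
open B9Eq349BlockDecayFromKernel (opNorm_block_comp_comp_block_le card_sites_block_le)

variable {d : ℕ} (L : ℕ) [NeZero L] (m : Fin (d + 1) → ℕ) [∀ i, NeZero (m i)] [∀ i, NeZero (fineP L m i)]
  {𝔸 : Type*} [Ring 𝔸] [Algebra ℂ 𝔸] {W : Type*} [NormedAddCommGroup W] [InnerProductSpace ℂ W] [FiniteDimensional ℂ W]
  (φ : W ≃ₗ[ℂ] 𝔸) (c₀ : ℝ) [Fact (0 < c₀)] (η : ℝ) (c₁ : ℝ) [Fact (0 < c₁)] (a' : ℝ) (hη : η ≠ 0) (ha : 0 < a')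

/-! ## §1 The kernel of the flat `P(1) = 1 − R(1)` -/

include hη ha in
/-- **THE KERNEL OF `1 − R(1)`**: `((1 − R(1))f)(x) = Σ_{x′} (Σ_{y,y′} A₀(x,y)·c(y,y′)·B(y′,x′))•f(x′)` with `A₀` = the `G′(1)Q̃′†`-kernel, `c` = the `(Q̃′G′(1)²Q̃′†)⁻¹`-kernel,
`B` = the `Q̃′G′(1)`-kernel ((3.25): `(1 − R(1))f = G′Q̃′†((Q̃′G′²Q̃′†)⁻¹(Q̃′G′f))`). [cite: Balaban1985BackgroundPropagators, (3.25) p.394; Balaban1984PropagatorsI, (1.44) p.25] -/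
theorem equiv_flatP_apply (f : SiteL2K ℂ (d + 1) (fineP L m) c₀ W) (x : TSite (d + 1) (fineP L m)) :
    WL2.equiv ℂ (fun _ : TSite (d + 1) (fineP L m) => c₀) W
        ((LinearMap.toContinuousLinearMap
          (LinearMap.id - RofU L m φ η (fun _ : Bond (d + 1) (fineP L m) => (1 : 𝔸ˣ)) (c₀ := c₀))) f) x =
      ∑ x' : TSite (d + 1) (fineP L m), (∑ y : TSite (d + 1) m, ∑ y' : TSite (d + 1) m,
        (((((η * L) ^ 2 * (c₁ / (c₀ * (L : ℝ) ^ (d + 1)))) : ℝ) : ℂ) * KT L (a' * (η * L) ^ 2 * (c₁ / (c₀ * (L : ℝ) ^ (d + 1)))) 0 m (liftSite x) (liftSite y)) *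
        ((((c₀ / c₁ * ((η * L) ^ 2 * (c₁ / (c₀ * (L : ℝ) ^ (d + 1)))) ^ 2 * (L : ℝ) ^ (d + 1))⁻¹ : ℝ) : ℂ) * torusKernel145M L (a' * (η * L) ^ 2 * (c₁ / (c₀ * (L : ℝ) ^ (d + 1)))) m (liftSite y - liftSite y')) *
        (((c₀ / c₁ * ((η * L) ^ 2 * (c₁ / (c₀ * (L : ℝ) ^ (d + 1)))) : ℝ) : ℂ) * conj (KT L (a' * (η * L) ^ 2 * (c₁ / (c₀ * (L : ℝ) ^ (d + 1)))) 0 m (liftSite x') (liftSite y')))) • WL2.equiv ℂ (fun _ : TSite (d + 1) (fineP L m) => c₀) W f x' := by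
  have hpos1 := laplacePrimeA_one_pos L m φ η a' hη ha (c₀ := c₀) (c₁ := c₁)
  have hX := QGGQ_pos_one L m φ c₀ η c₁ a' hη ha
  have h1 : ((LinearMap.id - RofU L m φ η (fun _ : Bond (d + 1) (fineP L m) => (1 : 𝔸ˣ)) (c₀ := c₀) :
      SiteL2K ℂ (d + 1) (fineP L m) c₀ W →ₗ[ℂ] SiteL2K ℂ (d + 1) (fineP L m) c₀ W) f) =
      GpOfU L m φ η (fun _ : Bond (d + 1) (fineP L m) => (1 : 𝔸ˣ)) a' (c₁ := c₁) (laplacePrimeA_one_pos L m φ η a' hη ha)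
        (LinearMap.adjoint ((WL2.linearEquiv ℂ ℂ (fun _ : TSite (d + 1) m => c₁)).symm.toLinearMap ∘ₗ
          QprimeW L m φ (fun _ : Bond (d + 1) (fineP L m) => (1 : 𝔸ˣ)) (c₀ := c₀))
          (greenK _ hX
            (((WL2.linearEquiv ℂ ℂ (fun _ : TSite (d + 1) m => c₁)).symm.toLinearMap ∘ₗ
          QprimeW L m φ (fun _ : Bond (d + 1) (fineP L m) => (1 : 𝔸ˣ)) (c₀ := c₀))
              (GpOfU L m φ η (fun _ : Bond (d + 1) (fineP L m) => (1 : 𝔸ˣ)) a' (c₁ := c₁) (laplacePrimeA_one_pos L m φ η a' hη ha) f)))) := by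
    rw [LinearMap.sub_apply, LinearMap.id_apply, RofU_eq_formula_one L m φ c₀ η c₁ a' hη ha f, sub_sub_cancel]
  rw [LinearMap.coe_toContinuousLinearMap', h1, equiv_GpQadj_one_apply L m φ c₀ η c₁ hη ha hpos1 _ x]
  simp only [equiv_greenK_QGGQ_one_apply L m φ c₀ η c₁ hη ha hpos1 hX,
    equiv_QGp_one_apply L m φ c₀ η c₁ hη ha hpos1 f, Finset.smul_sum, smul_smul]
  simp only [Finset.sum_smul]
  conv_rhs => rw [Finset.sum_comm (β := W)]
  refine Finset.sum_congr rfl fun y _ => ?_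
  conv_rhs => rw [Finset.sum_comm (β := W)]
  refine Finset.sum_congr rfl fun y' _ => Finset.sum_congr rfl fun x' _ => ?_
  rw [← mul_assoc]

/-! ## §2 The sites→sites block decay at the flat background -/

include hη ha in
/-- **SITES→SITES BLOCK DECAY OF `1 − R(1)`** — from the DISPLAYED torus letters `hbA` (b04's `K_T` at `(L, a, 0, m)`), `hbc` (pv17's `torusKernel145M` at `(L, a, m)`),
common rate `κ₀ > 0`, and any `0 ≤ r < κ₀`: for every block family `P^S` on the fine sites and all `y₀, y₁`,
`‖P^S_{y₁} ∘L (1 − R(1)) ∘L P^S_{y₀}‖ ≤ L^{d+1}·(K_{A₀}K_cK_B·K_{d+1}(κ₀−r)²)·e^{−(r·d_m(y₀,y₁))}`, `K_{A₀} = ρM_A`, `K_c = σ⁻¹M_c`, `K_B = (c₀∕c₁)ρM_A`.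
[cite: Balaban1985BackgroundPropagators, (3.49) p.399, (3.25) p.394; Balaban1984PropagatorsI, (1.45) p.26; Balaban1983RegularityDecay, (2.48) p.585] -/
theorem flat_P_block_decay {MA Mc κ₀ r : ℝ} (hκ₀ : 0 < κ₀) (hr0 : 0 ≤ r) (hr : r < κ₀)
    (hbA : ∀ (τ : Fin (d + 1) → Fin L) (v : Fin (d + 1) → ℤ), ‖torusKernel248 L (a' * (η * L) ^ 2 * (c₁ / (c₀ * (L : ℝ) ^ (d + 1)))) 0 τ m v‖ ≤ MA * Real.exp (-(κ₀ * torusSupNorm m v)))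
    (hbc : ∀ v : Fin (d + 1) → ℤ, ‖torusKernel145M L (a' * (η * L) ^ 2 * (c₁ / (c₀ * (L : ℝ) ^ (d + 1)))) m v‖ ≤ Mc * Real.exp (-(κ₀ * torusSupNorm m v))) :
    ∀ (PS : TSite (d + 1) m → SiteL2K ℂ (d + 1) (fineP L m) c₀ W →L[ℂ] SiteL2K ℂ (d + 1) (fineP L m) c₀ W),
      (∀ (y : TSite (d + 1) m) (f : SiteL2K ℂ (d + 1) (fineP L m) c₀ W) (x : TSite (d + 1) (fineP L m)),
        WL2.equiv ℂ (fun _ : TSite (d + 1) (fineP L m) => c₀) W (PS y f) x =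
          if blockCoord L m x = y then WL2.equiv ℂ (fun _ : TSite (d + 1) (fineP L m) => c₀) W f x else 0) →
      ∀ y₀ y₁ : TSite (d + 1) m, ‖PS y₁ ∘L (LinearMap.toContinuousLinearMap
          (LinearMap.id - RofU L m φ η (fun _ : Bond (d + 1) (fineP L m) => (1 : 𝔸ˣ)) (c₀ := c₀))) ∘L PS y₀‖ ≤
        (L : ℝ) ^ (d + 1) *
          ((((η * L) ^ 2 * (c₁ / (c₀ * (L : ℝ) ^ (d + 1)))) * MA) * ((c₀ / c₁ * ((η * L) ^ 2 * (c₁ / (c₀ * (L : ℝ) ^ (d + 1)))) ^ 2 * (L : ℝ) ^ (d + 1))⁻¹ * Mc) * (c₀ / c₁ * ((η * L) ^ 2 * (c₁ / (c₀ * (L : ℝ) ^ (d + 1)))) * MA) *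
            latticeConst (d + 1) (κ₀ - r) ^ 2) * Real.exp (-(r * tdist m y₀ y₁)) := by
  classical
  intro PS hPS y₀ y₁
  have hc₀ : 0 < c₀ := Fact.out
  have hc₁ : 0 < c₁ := Fact.out
  have hL0 : (0 : ℝ) < L := by exact_mod_cast Nat.pos_of_ne_zero (NeZero.ne L)
  have hm : ∀ i, 1 ≤ m i := one_le_period m
  have hρ : 0 ≤ ((η * L) ^ 2 * (c₁ / (c₀ * (L : ℝ) ^ (d + 1)))) := by positivity
  have hσi : 0 ≤ (c₀ / c₁ * ((η * L) ^ 2 * (c₁ / (c₀ * (L : ℝ) ^ (d + 1)))) ^ 2 * (L : ℝ) ^ (d + 1))⁻¹ := by positivity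
  have hB0 : 0 ≤ c₀ / c₁ * ((η * L) ^ 2 * (c₁ / (c₀ * (L : ℝ) ^ (d + 1)))) := by positivity
  have hMA : 0 ≤ MA := le_of_mul_le_mul_right (by rw [zero_mul]; exact (norm_nonneg _).trans (hbA (fun _ => 0) 0)) (Real.exp_pos _)
  have hMc : 0 ≤ Mc := le_of_mul_le_mul_right (by rw [zero_mul]; exact (norm_nonneg _).trans (hbc 0)) (Real.exp_pos _)
  -- the three kernel letters
  have hA : ∀ (x : TSite (d + 1) (fineP L m)) (y : TSite (d + 1) m),
      ‖((((η * L) ^ 2 * (c₁ / (c₀ * (L : ℝ) ^ (d + 1)))) : ℝ) : ℂ) * KT L (a' * (η * L) ^ 2 * (c₁ / (c₀ * (L : ℝ) ^ (d + 1)))) 0 m (liftSite x) (liftSite y)‖ ≤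
        ((η * L) ^ 2 * (c₁ / (c₀ * (L : ℝ) ^ (d + 1)))) * MA * Real.exp (-(κ₀ * tdist m (blockCoord L m x) y)) := fun x y => by
    rw [norm_mul, Complex.norm_real, Real.norm_eq_abs, abs_of_nonneg hρ]
    calc _ ≤ ((η * L) ^ 2 * (c₁ / (c₀ * (L : ℝ) ^ (d + 1)))) * (MA * Real.exp (-(κ₀ * tdist m (blockCoord L m x) y))) :=
          mul_le_mul_of_nonneg_left (norm_KT_liftSite_le L m hκ₀.le hbA x y) hρ
      _ = _ := by ring
  have hk := norm_conv3_le (δ := tdist m) (πS := blockCoord L m) (πE := blockCoord L m) (tdist_nonneg m) (tdist_triangle hm)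
    (A := (fun x y => ((((η * L) ^ 2 * (c₁ / (c₀ * (L : ℝ) ^ (d + 1)))) : ℝ) : ℂ) * KT L (a' * (η * L) ^ 2 * (c₁ / (c₀ * (L : ℝ) ^ (d + 1)))) 0 m (liftSite x) (liftSite y)))
    (c := (fun y y' => ((((c₀ / c₁ * ((η * L) ^ 2 * (c₁ / (c₀ * (L : ℝ) ^ (d + 1)))) ^ 2 * (L : ℝ) ^ (d + 1))⁻¹ : ℝ) : ℂ) * torusKernel145M L (a' * (η * L) ^ 2 * (c₁ / (c₀ * (L : ℝ) ^ (d + 1)))) m (liftSite y - liftSite y'))))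
    (B := (fun y' x' => (((c₀ / c₁ * ((η * L) ^ 2 * (c₁ / (c₀ * (L : ℝ) ^ (d + 1)))) : ℝ) : ℂ) * conj (KT L (a' * (η * L) ^ 2 * (c₁ / (c₀ * (L : ℝ) ^ (d + 1)))) 0 m (liftSite x') (liftSite y')))))
    (k := (fun x x' => ∑ y : TSite (d + 1) m, ∑ y' : TSite (d + 1) m,
        (((((η * L) ^ 2 * (c₁ / (c₀ * (L : ℝ) ^ (d + 1)))) : ℝ) : ℂ) * KT L (a' * (η * L) ^ 2 * (c₁ / (c₀ * (L : ℝ) ^ (d + 1)))) 0 m (liftSite x) (liftSite y)) *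
        ((((c₀ / c₁ * ((η * L) ^ 2 * (c₁ / (c₀ * (L : ℝ) ^ (d + 1)))) ^ 2 * (L : ℝ) ^ (d + 1))⁻¹ : ℝ) : ℂ) * torusKernel145M L (a' * (η * L) ^ 2 * (c₁ / (c₀ * (L : ℝ) ^ (d + 1)))) m (liftSite y - liftSite y')) *
        (((c₀ / c₁ * ((η * L) ^ 2 * (c₁ / (c₀ * (L : ℝ) ^ (d + 1)))) : ℝ) : ℂ) * conj (KT L (a' * (η * L) ^ 2 * (c₁ / (c₀ * (L : ℝ) ^ (d + 1)))) 0 m (liftSite x') (liftSite y')))))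
    (fun _ _ => rfl) (mul_nonneg hρ hMA) (mul_nonneg hσi hMc) (mul_nonneg hB0 hMA) hr0 hr.le hA
    (fun y y' => norm_flatc_le L m hκ₀.le hσi hbc y y')
    (fun y' x' => norm_flatB_le L m hκ₀.le hB0 hbA y' x')
    (fun y => torusSum_le (d + 1) hm (sub_pos.mpr hr) y)
  -- blocks from entries, sites → sites, same weights (`ρ = 1`), `L^{d+1}` sites per block on both sides
  set Kxx : ℝ := (((η * L) ^ 2 * (c₁ / (c₀ * (L : ℝ) ^ (d + 1)))) * MA) * ((c₀ / c₁ * ((η * L) ^ 2 * (c₁ / (c₀ * (L : ℝ) ^ (d + 1)))) ^ 2 * (L : ℝ) ^ (d + 1))⁻¹ * Mc) * (c₀ / c₁ * ((η * L) ^ 2 * (c₁ / (c₀ * (L : ℝ) ^ (d + 1)))) * MA) *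
            latticeConst (d + 1) (κ₀ - r) ^ 2 with hKxx
  have hKxx0 : 0 ≤ Kxx := by
    rw [hKxx]; have := latticeConst_nonneg (d + 1) (sub_pos.mpr hr).le; positivity
  have h := opNorm_block_comp_comp_block_le (πS := blockCoord L m) (πE := blockCoord L m) (PS := PS) (PE := PS)
    (T := LinearMap.toContinuousLinearMap (LinearMap.id - RofU L m φ η (fun _ : Bond (d + 1) (fineP L m) => (1 : 𝔸ˣ)) (c₀ := c₀)))
    (t := (fun x x' => (∑ y : TSite (d + 1) m, ∑ y' : TSite (d + 1) m,
        (((((η * L) ^ 2 * (c₁ / (c₀ * (L : ℝ) ^ (d + 1)))) : ℝ) : ℂ) * KT L (a' * (η * L) ^ 2 * (c₁ / (c₀ * (L : ℝ) ^ (d + 1)))) 0 m (liftSite x) (liftSite y)) *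
        ((((c₀ / c₁ * ((η * L) ^ 2 * (c₁ / (c₀ * (L : ℝ) ^ (d + 1)))) ^ 2 * (L : ℝ) ^ (d + 1))⁻¹ : ℝ) : ℂ) * torusKernel145M L (a' * (η * L) ^ 2 * (c₁ / (c₀ * (L : ℝ) ^ (d + 1)))) m (liftSite y - liftSite y')) *
        (((c₀ / c₁ * ((η * L) ^ 2 * (c₁ / (c₀ * (L : ℝ) ^ (d + 1)))) : ℝ) : ℂ) * conj (KT L (a' * (η * L) ^ 2 * (c₁ / (c₀ * (L : ℝ) ^ (d + 1)))) 0 m (liftSite x') (liftSite y')))) •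
          ContinuousLinearMap.id ℂ W))
    hPS hPS (fun f x => by rw [equiv_flatP_apply L m φ c₀ η c₁ a' hη ha f x]; rfl) y₀ y₁
    (K := Kxx * Real.exp (-(r * tdist m y₀ y₁))) (ρ := 1) (NS := L ^ (d + 1)) (NE := L ^ (d + 1)) (by positivity) zero_le_one
    (fun x x' hx hx' => by
      rw [norm_smul]
      refine (mul_le_of_le_one_right (norm_nonneg _) ContinuousLinearMap.norm_id_le).trans ?_
      have hkk := hk x x'
      rw [hx, hx', tdist_symm hm] at hkk
      simpa only [hKxx, mul_assoc] using hkk)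
    (fun _ _ _ _ => by rw [one_mul])
    (card_sites_block_le y₀) (card_sites_block_le y₁)
  refine h.trans (le_of_eq ?_)
  have hsq : Real.sqrt (1 * ((L ^ (d + 1) : ℕ) : ℝ) * ((L ^ (d + 1) : ℕ) : ℝ)) = (L : ℝ) ^ (d + 1) := by
    rw [one_mul, Real.sqrt_mul_self (by positivity), Nat.cast_pow]
  rw [hsq, hKxx]; ring

/-! ## §3 The package: a positive rate and a volume-independent constant -/

omit [NeZero L] [∀ i, NeZero (m i)] [∀ i, NeZero (fineP L m i)] in
/-- positivity of b04's periodisation constant (private helper, as in the bonds←sites cousin). [folklore] -/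
private theorem periodConst_nonneg'' {κ : ℝ} (hκ : 0 < κ) (n : ℕ) : 0 ≤ periodConst κ n := by
  unfold periodConst
  refine pow_nonneg (div_nonneg (by positivity) ?_) _
  have hκ' : (0 : ℝ) < κ / (n + 1) := by positivity
  have h1 : Real.exp (-(κ / (n + 1))) < 1 := Real.exp_lt_one_iff.mpr (by linarith)
  linarith

include hη in
/-- **THE PACKAGE — SITES→SITES BLOCK DECAY OF `1 − R(1)` WITH A κ₁-FREE RATE**: instantiating `hbA`∕`hbc` of `flat_P_block_decay` by [B4] (2.35) on the torus
(`B4Torus248Decay.kernel248_torusKernel_decay_torusMetric`) and [B5′] (1.45)'s inverse (`B5Torus145Decay.inverse145_torusKernelM_decay_torusMetric`) at `a′ := 1`,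
`c₁ := c₀`: there are `r > 0` (half the smaller strip letter over `d+1`, a function of `(d, (ηL)²∕L^{d+1})` only) and `C ≥ 0` such that FOR EVERY VOLUME `N`:
`‖P^S_{y₁} ∘L (1 − R(1)) ∘L P^S_{y₀}‖ ≤ C·e^{−(r·d_m(y₀,y₁))}` for all block families on the fine sites and all `y₀, y₁` — the `hdec` letter of
`B9Eq389CutoffTailFromBlockDecay.norm_mul_apply_le_of_block_decay` at `T := 1 − R(1)`. [cite: Balaban1985BackgroundPropagators, (3.49) p.399;
Balaban1984PropagatorsI, (1.126) p.38; Balaban1983RegularityDecay, Lemma 2.4 (2.35) p.582] -/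
theorem exists_flat_P_block_decay :
    ∃ r C : ℝ, 0 < r ∧ 0 ≤ C ∧ ∀ (N : Fin (d + 1) → ℕ) [∀ i, NeZero (N i)] [∀ i, NeZero (fineP L N i)],
    ∀ (PS : TSite (d + 1) N → SiteL2K ℂ (d + 1) (fineP L N) c₀ W →L[ℂ] SiteL2K ℂ (d + 1) (fineP L N) c₀ W),
      (∀ (y : TSite (d + 1) N) (f : SiteL2K ℂ (d + 1) (fineP L N) c₀ W) (x : TSite (d + 1) (fineP L N)),
        WL2.equiv ℂ (fun _ : TSite (d + 1) (fineP L N) => c₀) W (PS y f) x =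
          if blockCoord L N x = y then WL2.equiv ℂ (fun _ : TSite (d + 1) (fineP L N) => c₀) W f x else 0) →
      ∀ y₀ y₁ : TSite (d + 1) N, ‖PS y₁ ∘L (LinearMap.toContinuousLinearMap
          (LinearMap.id - RofU L N φ η (fun _ : Bond (d + 1) (fineP L N) => (1 : 𝔸ˣ)) (c₀ := c₀))) ∘L PS y₀‖ ≤
        C * Real.exp (-(r * tdist N y₀ y₁)) := by
  have hc₀ : 0 < c₀ := Fact.out
  have hL0 : (0 : ℝ) < L := by exact_mod_cast Nat.pos_of_ne_zero (NeZero.ne L)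
  have hA : 0 < ((1 : ℝ) * (η * L) ^ 2 * (c₀ / (c₀ * (L : ℝ) ^ (d + 1)))) := by
    have : 0 < (η * L) ^ 2 := by positivity
    positivity
  obtain ⟨κ₁, M₁, hκ₁, hM₁, h₁⟩ := kernel248_torusKernel_decay_torusMetric d ((1 : ℝ) * (η * L) ^ 2 * (c₀ / (c₀ * (L : ℝ) ^ (d + 1)))) ((1 : ℝ) * (η * L) ^ 2 * (c₀ / (c₀ * (L : ℝ) ^ (d + 1)))) 0 hA
  obtain ⟨κ₂, c₂, hκ₂, hc₂, h₂⟩ := inverse145_torusKernelM_decay_torusMetric d ((1 : ℝ) * (η * L) ^ 2 * (c₀ / (c₀ * (L : ℝ) ^ (d + 1)))) ((1 : ℝ) * (η * L) ^ 2 * (c₀ / (c₀ * (L : ℝ) ^ (d + 1)))) hA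
  have hd1 : (0 : ℝ) < (d : ℝ) + 1 := by positivity
  set κ₀ : ℝ := min κ₁ κ₂ / ((d : ℝ) + 1) with hκ₀_def
  have hκ₀ : 0 < κ₀ := div_pos (lt_min hκ₁ hκ₂) hd1
  have hκ₀₁ : κ₀ ≤ κ₁ / ((d : ℝ) + 1) := div_le_div_of_nonneg_right (min_le_left _ _) hd1.le
  have hκ₀₂ : κ₀ ≤ κ₂ / ((d : ℝ) + 1) := div_le_div_of_nonneg_right (min_le_right _ _) hd1.le
  have h3 : 0 ≤ M₁ * periodConst κ₁ d := mul_nonneg hM₁ (periodConst_nonneg'' hκ₁ d)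
  have h4 : 0 ≤ c₂⁻¹ * periodConst κ₂ d := mul_nonneg (inv_nonneg.mpr hc₂.le) (periodConst_nonneg'' hκ₂ d)
  have h5 : 0 ≤ latticeConst (d + 1) (κ₀ - κ₀ / 2) := latticeConst_nonneg _ (by linarith)
  refine ⟨κ₀ / 2,
    ((L : ℝ) ^ (d + 1) *
      ((((η * L) ^ 2 * (c₀ / (c₀ * (L : ℝ) ^ (d + 1)))) * (M₁ * periodConst κ₁ d)) * ((c₀ / c₀ * ((η * L) ^ 2 * (c₀ / (c₀ * (L : ℝ) ^ (d + 1)))) ^ 2 * (L : ℝ) ^ (d + 1))⁻¹ * (c₂⁻¹ * periodConst κ₂ d)) *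
        (c₀ / c₀ * ((η * L) ^ 2 * (c₀ / (c₀ * (L : ℝ) ^ (d + 1)))) * (M₁ * periodConst κ₁ d)) * latticeConst (d + 1) (κ₀ - κ₀ / 2) ^ 2)),
    half_pos hκ₀, by positivity, fun N _ _ => ?_⟩
  · have hN : ∀ i, 1 ≤ N i := one_le_period N
    have hbA : ∀ (τ : Fin (d + 1) → Fin L) (v : Fin (d + 1) → ℤ),
        ‖torusKernel248 L ((1 : ℝ) * (η * L) ^ 2 * (c₀ / (c₀ * (L : ℝ) ^ (d + 1)))) 0 τ N v‖ ≤
          M₁ * periodConst κ₁ d * Real.exp (-(κ₀ * torusSupNorm N v)) := by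
      intro τ v
      refine (h₁ L _ 0 le_rfl le_rfl le_rfl le_rfl τ N hN v).trans (mul_le_mul_of_nonneg_left (Real.exp_le_exp.mpr ?_) h3)
      have := torusSupNorm_nonneg hN v
      nlinarith
    have hbc : ∀ v : Fin (d + 1) → ℤ, ‖torusKernel145M L ((1 : ℝ) * (η * L) ^ 2 * (c₀ / (c₀ * (L : ℝ) ^ (d + 1)))) N v‖ ≤
        c₂⁻¹ * periodConst κ₂ d * Real.exp (-(κ₀ * torusSupNorm N v)) := by
      intro v
      refine (h₂ L _ le_rfl le_rfl N hN v).trans (mul_le_mul_of_nonneg_left (Real.exp_le_exp.mpr ?_) h4)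
      have := torusSupNorm_nonneg hN v
      nlinarith
    exact flat_P_block_decay L N φ c₀ η c₀ 1 hη one_pos hκ₀ (half_pos hκ₀).le (half_lt_self hκ₀) hbA hbc

end Literature.MathematicalPhysics.QuantumFieldTheory.Balaban1983to89.B9Eq349FlatPBlockDecay

end
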